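import Summits.ResolutionOfSingularities.ResolutionOfSingularities.Theorems.PurelyInseparableDim4ResConeLightPairTail
import Summits.ResolutionOfSingularities.ResolutionOfSingularities.Theorems.PurelyInseparableDim4ResConePairReduction
import Summits.ResolutionOfSingularities.ResolutionOfSingularities.Theorems.PurelyInseparableDim4WindowGame
import HarnessLib
import HarnessLib.Audit.Tags

/-!
# Purely inseparable four-folds — NO LOSS-FREE BINARY-CONE TAIL (K2(p) lane, SLICE C (C13): the corner game on the
# boundary pair forces a loss-free `e_G ≡ 2` tail to become LIGHT, and light pair tails are excluded;
# file-holder res-dim4-p-5 g3, over res-dim4-p-11 g3's (C10) `no_light_pair_tail`)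

[OURS · counted 0 · cell `res-dim4-pi` · K2(p) lane (desk WORDS #78 (d), #80 (d), #96 (b), #105 (d)) · seat p-5 g3.]
Nothing here proves K2(p), `NoIsolatedTrap p p` or resolution of singularities in dimension ≥ 4 / char. `p`.

On a LOSS-FREE (`b k i ≠ 0 → (c k).r i = 0`) constant-`(d < p, e_G = 2)` tail of an isolated above-floor witnessed
`Step0 p` chain with `x^{r₀} ∣ F₀`, `…PairReduction.exists_pair_of_lossfree` gives a permanent boundary pair
`{a, a′}` carrying all chart letters.  This file runs the boundary LEDGER of such a tail:
* `r_succ_of_lossfree` — the boundary follows the PURE-CORNER law `r_{k+1} = r_k.update (j k) (|r_k| − (p − d))`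
  (translated letters are free, so nothing is lost), i.e. `(c (k₂ + t)).r = cornerTraj _ (p − d) (c k₂).r t`
  (`r_eq_cornerTraj`), and the passive mass `P = degIn (others) r` is constant (`…CornerGame.degIn_passive_cornerTraj`);
* `eventually_light_of_lossfree_pair` — hence `(r a, r a′)` plays the window game of `…WindowGame` with
  `n = p − d − P`, legal for ever by the band `p < o_k < 2p`; FT forbids an eventually constant word, so the pair is
  absorbed into the quadrant (`WindowGame.all_absorbed_of_not_eventually_constant`), where `r a + r a′` is
  non-decreasing and bounded, hence eventually both coordinates equal `n`: the tail is eventually LIGHT (with equality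
  `r a + r a′ = 2 · r_{k+1} (j k)`);  the case `P > p − d` makes `r a + r a′` increase at every step — impossible;
* **`no_lossfree_tail`** — THE THEOREM: there is no such tail (light pair tails are excluded by
  `…LightPairTail.no_light_pair_tail`, res-dim4-p-11 g3, over C8/C9).
So every binary-cone (slice C) trap, if any, translates boundary letters infinitely often (LOSSY steps).  K2(p) OPEN.
[cite: CossartJannsenSaito2020, Thm. 3.10(4), Thm. 3.14, Thm. 9.3, Lemma 13.2, Lemma 13.4, Thm. 13.7]
[cite: HauserPerlega2019PRIMS, §2 (transform D′ of D)]
bears_on: LADDER-RESOLUTION:D157-DOOR2 (res-dim4-pi · K2(p) = `RidgeBudget.NoAboveFloorTrap p p` · slice C).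
Supports stmt-ResolutionOfSingularities-16155 (helper).
-/

set_option linter.dupNamespace false -- mandated namespace of this single-conjunct summit

noncomputable section

namespace Summit.ResolutionOfSingularities.ResolutionOfSingularities.Theorems.PIDim4

namespace ResCone

open MvPolynomial Finset
open Literature.AlgebraicGeometry.Resolution
open Literature.AlgebraicGeometry.Resolution.CentreBlowup
open Literature.AlgebraicGeometry.Resolution.Hauser2010
open Literature.AlgebraicGeometry.Resolution.HauserPerlega2019

variable {K : Type} [Field K]

section LossFreeLedger

variable (p : ℕ) [Fact p.Prime] [CharP K p] [DecidableEq K]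

omit [CharP K p] in
/-- **The boundary ledger of a loss-free step is the pure-corner law**: `r_{k+1} = r_k.update (j k) (|r_k| − (p − d))`.
[cite: HauserPerlega2019PRIMS, §2 (transform D′ of D)] -/
theorem r_succ_of_lossfree {c : ℕ → State K} {j : ℕ → Fin 4} {b : ℕ → Fin 4 → K}
    (hc : ∀ k, IsIsolated p (c k).F ∧ Step0 p (c k) (c (k + 1))) (hw : FreeTail.IsWitnessedChain p c j b)
    (hr0 : ∀ e ∈ (c 0).F.support, (c 0).r ≤ e) (hfloor : ∀ k, ordZero (c k).F ≠ p) {d : ℕ} (hdp : d < p) {k : ℕ}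
    (hshade : (c k).shade = (d : ℕ∞)) (hloss : ∀ i, b k i ≠ 0 → (c k).r i = 0) :
    (c (k + 1)).r = (c k).r.update (j k) ((c k).r.degree - (p - d)) := by
  obtain ⟨o, ho, hpo, -⟩ := chain_band p hc hfloor k
  have hrk := IsolatedBand.isolated_chain_forall_le hc hr0 k
  have hdeg := degree_r_le ho hrk
  have hd := ordZero_sub_degree_eq_of_shade ho hshade
  have hfilter : (c k).r.filter (fun i => b k i = 0) = (c k).r := by
    ext i
    rw [Finsupp.filter_apply]
    split_ifs with hbi
    · rfl
    · exact (hloss i hbi).symm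
  rw [(hw k).2.2.2.2, step_r_univ p (j k) (hw k).2.1 (c k) ho hrk, hfilter]
  congr 1
  omega

omit [CharP K p] in
/-- **The boundary of a loss-free pair tail is a corner trajectory**: from `k₂` on,
`(c (k₂ + t)).r = cornerTraj (j (k₂ + ·)) (p − d) (c k₂).r t`. [OURS] [cite: CossartJannsenSaito2020, Lemma 13.2] -/
theorem r_eq_cornerTraj {c : ℕ → State K} {j : ℕ → Fin 4} {b : ℕ → Fin 4 → K}
    (hc : ∀ k, IsIsolated p (c k).F ∧ Step0 p (c k) (c (k + 1))) (hw : FreeTail.IsWitnessedChain p c j b)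
    (hr0 : ∀ e ∈ (c 0).F.support, (c 0).r ≤ e) (hfloor : ∀ k, ordZero (c k).F ≠ p) {k₂ d : ℕ} (hdp : d < p)
    (hshade : ∀ k, k₂ ≤ k → (c k).shade = (d : ℕ∞)) (hloss : ∀ k, k₂ ≤ k → ∀ i, b k i ≠ 0 → (c k).r i = 0) (t : ℕ) :
    (c (k₂ + t)).r = cornerTraj (fun t => j (k₂ + t)) (p - d) (c k₂).r t := by
  induction t with
  | zero => simp [cornerTraj_zero]
  | succ t ih =>
    rw [cornerTraj_succ, ← ih, show k₂ + (t + 1) = k₂ + t + 1 by ring]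
    exact r_succ_of_lossfree p hc hw hr0 hfloor hdp (hshade (k₂ + t) (by omega)) (hloss (k₂ + t) (by omega))

/-- **A LOSS-FREE PAIR TAIL BECOMES LIGHT**: on a loss-free constant-`(d < p, e_G = 2)` tail whose chart letters lie in
the permanent boundary pair `{a, a′}` from `k₂` on, there is `k₃ ≥ k₂` from which on every step is light (indeed
`r a + r a′ = 2 · r_{k+1} (j k)`). [OURS]
[cite: CossartJannsenSaito2020, Thm. 3.14, Lemma 13.2, Lemma 13.4, Thm. 13.7] -/
theorem eventually_light_of_lossfree_pair {c : ℕ → State K} {j : ℕ → Fin 4} {b : ℕ → Fin 4 → K}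
    (hc : ∀ k, IsIsolated p (c k).F ∧ Step0 p (c k) (c (k + 1))) (hw : FreeTail.IsWitnessedChain p c j b)
    (hr0 : ∀ e ∈ (c 0).F.support, (c 0).r ≤ e) (hfloor : ∀ k, ordZero (c k).F ≠ p) {k₂ d : ℕ} (hdp : d < p)
    (hshade : ∀ k, k₂ ≤ k → (c k).shade = (d : ℕ∞)) {a a' : Fin 4} (haa : a ≠ a')
    (hletters : ∀ k, k₂ ≤ k → (j k = a ∨ j k = a'))
    (hloss : ∀ k, k₂ ≤ k → ∀ i, b k i ≠ 0 → (c k).r i = 0) :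
    ∃ k₃, k₂ ≤ k₃ ∧ ∀ k, k₃ ≤ k → (c k).r a + (c k).r a' ≤ 2 * (c (k + 1)).r (j k) := by
  classical
  -- the corner trajectory, the constant passive mass `P`, and the band
  set S : Finset (Fin 4) := (Finset.univ.erase a).erase a' with hS
  set f : ℕ → (Fin 4 →₀ ℕ) := cornerTraj (fun t => j (k₂ + t)) (p - d) (c k₂).r with hf
  have hr : ∀ t, (c (k₂ + t)).r = f t := r_eq_cornerTraj p hc hw hr0 hfloor hdp hshade hloss
  have hjT : ∀ t, (fun t => j (k₂ + t)) t = a ∨ (fun t => j (k₂ + t)) t = a' := fun t => hletters (k₂ + t) (by omega)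
  set P := degIn S (c k₂).r with hP
  have hPt : ∀ t, degIn S (f t) = P := fun t => degIn_passive_cornerTraj hjT (p - d) (c k₂).r t
  have hdegt : ∀ t, (f t).degree = f t a + f t a' + P := fun t => by
    rw [degree_eq_apply_add_apply_add_degIn haa, hPt t]
  have hband : ∀ t, p < f t a + f t a' + P + d ∧ f t a + f t a' + P + d < 2 * p := by
    intro t
    obtain ⟨o, ho, hpo, ho2⟩ := chain_band p hc hfloor (k₂ + t)
    have hd := ordZero_sub_degree_eq_of_shade ho (hshade (k₂ + t) (by omega))
    have hdeg := degree_r_le ho (IsolatedBand.isolated_chain_forall_le hc hr0 (k₂ + t))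
    rw [hr t, hdegt t] at hd hdeg
    constructor <;> omega
  -- the step of the pair `(f t a, f t a')`
  have hsucc : ∀ t, (f (t + 1) a, f (t + 1) a') =
      if j (k₂ + t) = a then (f t a + f t a' + P - (p - d), f t a') else (f t a, f t a + f t a' + P - (p - d)) := by
    intro t
    have h1 : f (t + 1) = (f t).update (j (k₂ + t)) ((f t).degree - (p - d)) := by
      rw [hf, cornerTraj_succ]
    rw [h1, hdegt t]
    rcases hletters (k₂ + t) (by omega) with hja | hja'
    · rw [if_pos hja, hja, Finsupp.coe_update, Function.update_self, Function.update_of_ne haa.symm]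
    · rw [if_neg (by rw [hja']; exact haa.symm), hja', Finsupp.coe_update, Function.update_self,
        Function.update_of_ne haa]
  -- FT: infinitely many letter changes
  have hchg : ∀ T, ∃ t, T ≤ t ∧ j (k₂ + t + 1) ≠ j (k₂ + t) := by
    intro T
    by_contra h
    push Not at h
    obtain ⟨m, hm⟩ := FreeTailProof.noIsolatedFreeTailAt_self p K c j b (k₂ + T) hw (fun n hn hsat => by
      have := h (n - k₂) (by omega)
      rw [show k₂ + (n - k₂) = n by omega] at this
      exact hsat.1 this)
    exact hm (hc m).1
  -- case `P > p − d`: the sum increases at every step — impossible in the band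
  by_cases hPd : p - d < P
  · exfalso
    have hinc : ∀ t, f 0 a + f 0 a' + t ≤ f t a + f t a' := by
      intro t
      induction t with
      | zero => simp
      | succ t ih =>
        have h := hsucc t
        have hb := hband t
        split_ifs at h with hja
        · simp only [Prod.mk.injEq] at h; omega
        · simp only [Prod.mk.injEq] at h; omega
    have h := hinc (2 * p)
    have hb := hband (2 * p)
    omega
  push Not at hPd
  -- the window game with `n = (p − d) − P`
  set n := (p - d) - P with hn
  set w : ℕ → Bool := fun t => decide (j (k₂ + t) = a) with hwd
  set q : Unit → ℕ → ℕ × ℕ := fun _ t => (f t a, f t a') with hq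
  have hstep : ∀ (i : Unit) t, q i (t + 1) =
      if w t then ((q i t).1 + (q i t).2 - n, (q i t).2) else ((q i t).1, (q i t).1 + (q i t).2 - n) := by
    intro _ t
    show (f (t + 1) a, f (t + 1) a') =
      if w t then (f t a + f t a' - n, f t a') else (f t a, f t a + f t a' - n)
    have hb := hband t
    rw [hsucc t]
    by_cases hja : j (k₂ + t) = a
    · have hw1 : w t = true := by simp only [hwd, hja, decide_true]
      rw [if_pos hja, hw1, if_pos rfl, Prod.mk.injEq]
      constructor <;> omega
    · have hw1 : w t = false := by simp only [hwd, hja, decide_false]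
      rw [if_neg hja, hw1, if_neg Bool.false_ne_true, Prod.mk.injEq]
      constructor <;> omega
  have hlow : ∀ (i : Unit) t, n < (q i t).1 + (q i t).2 := by
    intro _ t
    have hb := hband t
    simp only [hq]
    omega
  have hnc : ¬ ∃ (T : ℕ) (cst : Bool), ∀ t, T ≤ t → w t = cst := by
    rintro ⟨T, cst, hT⟩
    obtain ⟨t, hTt, hne⟩ := hchg T
    have h1 := hT t hTt
    have h2 := hT (t + 1) (by omega)
    rw [← show k₂ + (t + 1) = k₂ + t + 1 by ring] at hne
    rcases hletters (k₂ + t) (by omega) with hja | hja' <;>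
      rcases hletters (k₂ + (t + 1)) (by omega) with hjb | hjb'
    · exact hne (hjb.trans hja.symm)
    · have : w (t + 1) = false := by simp only [hwd, hjb', haa.symm, decide_false]
      have : w t = true := by simp only [hwd, hja, decide_true]
      simp_all
    · have : w (t + 1) = true := by simp only [hwd, hjb, decide_true]
      have : w t = false := by simp only [hwd, hja', haa.symm, decide_false]
      simp_all
    · exact hne (hjb'.trans hja'.symm)
  obtain ⟨T, hT⟩ := WindowGame.all_absorbed_of_not_eventually_constant n w q hstep hlow hnc
  have hQ : ∀ t, T ≤ t → n ≤ f t a ∧ n ≤ f t a' := fun t ht => by simpa only [hq] using hT () t ht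
  -- in the quadrant the sum is non-decreasing and bounded: eventually constant
  have hmono : ∀ t, T ≤ t → f t a + f t a' ≤ f (t + 1) a + f (t + 1) a' := by
    intro t ht
    have h := hsucc t
    have hq' := hQ t ht
    split_ifs at h with hja
    · simp only [Prod.mk.injEq] at h; omega
    · simp only [Prod.mk.injEq] at h; omega
  have hmonoT : ∀ t t', T ≤ t → t ≤ t' → f t a + f t a' ≤ f t' a + f t' a' := by
    intro t t' ht htt'
    induction t', htt' using Nat.le_induction with
    | base => exact le_rfl
    | succ t' htt' ih => exact ih.trans (hmono t' (by omega))
  -- a time after which the sum is constant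
  have hconst : ∃ T', T ≤ T' ∧ ∀ t, T' ≤ t → f (t + 1) a + f (t + 1) a' = f t a + f t a' := by
    by_contra h
    push Not at h
    -- then the sum increases by one at least every step... choose witnesses iteratively: sum ≥ sum T + m
    have hgrow : ∀ m, ∃ t, T ≤ t ∧ f T a + f T a' + m ≤ f t a + f t a' := by
      intro m
      induction m with
      | zero => exact ⟨T, le_rfl, by omega⟩
      | succ m ih =>
        obtain ⟨t, hTt, hm⟩ := ih
        obtain ⟨t', htt', hne⟩ := h t hTt
        refine ⟨t' + 1, by omega, ?_⟩
        have h1 := hmonoT t t' hTt htt'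
        have h2 := hmono t' (by omega)
        omega
    obtain ⟨t, -, ht⟩ := hgrow (2 * p)
    have hb := hband t
    omega
  obtain ⟨T', hTT', hT'⟩ := hconst
  -- from `T'` on the non-chart coordinate equals `n`, so both coordinates equal `n` after the next change
  have hother : ∀ t, T' ≤ t → (j (k₂ + t) = a → f t a' = n) ∧ (j (k₂ + t) = a' → f t a = n) := by
    intro t ht
    have h := hsucc t
    have hq' := hQ t (by omega)
    have hc' := hT' t ht
    constructor
    · intro hja
      rw [if_pos hja] at h
      simp only [Prod.mk.injEq] at h; omega
    · intro hja'
      rw [if_neg (by rw [hja']; exact haa.symm)] at h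
      simp only [Prod.mk.injEq] at h; omega
  have hfix : ∀ t, T' ≤ t → f (t + 1) a = f t a ∧ f (t + 1) a' = f t a' := by
    intro t ht
    have h := hsucc t
    have ho := hother t ht
    split_ifs at h with hja
    · simp only [Prod.mk.injEq] at h
      have := ho.1 hja
      constructor <;> omega
    · have hja' : j (k₂ + t) = a' := (hletters (k₂ + t) (by omega)).resolve_left hja
      simp only [Prod.mk.injEq] at h
      have := ho.2 hja'
      constructor <;> omega
  have hfixT : ∀ t, T' ≤ t → f t a = f T' a ∧ f t a' = f T' a' := by
    intro t ht
    induction t, ht using Nat.le_induction with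
    | base => exact ⟨rfl, rfl⟩
    | succ t ht ih => exact ⟨(hfix t ht).1.trans ih.1, (hfix t ht).2.trans ih.2⟩
  obtain ⟨t₁, hT't₁, hne⟩ := hchg T'
  have hboth : f T' a = n ∧ f T' a' = n := by
    rw [← show k₂ + (t₁ + 1) = k₂ + t₁ + 1 by ring] at hne
    rcases hletters (k₂ + t₁) (by omega) with hja | hja' <;>
      rcases hletters (k₂ + (t₁ + 1)) (by omega) with hjb | hjb'
    · exact absurd (hjb.trans hja.symm) hne
    · exact ⟨by rw [← (hfixT (t₁ + 1) (by omega)).1]; exact (hother (t₁ + 1) (by omega)).2 hjb',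
        by rw [← (hfixT t₁ hT't₁).2]; exact (hother t₁ hT't₁).1 hja⟩
    · exact ⟨by rw [← (hfixT t₁ hT't₁).1]; exact (hother t₁ hT't₁).2 hja',
        by rw [← (hfixT (t₁ + 1) (by omega)).2]; exact (hother (t₁ + 1) (by omega)).1 hjb⟩
    · exact absurd (hjb'.trans hja'.symm) hne
  refine ⟨k₂ + T', by omega, fun k hk => ?_⟩
  obtain ⟨t, rfl⟩ : ∃ t, k = k₂ + t := ⟨k - k₂, by omega⟩
  have ht : T' ≤ t := by omega
  have h1 := hfixT t ht
  have h2 := hfixT (t + 1) (by omega)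
  rw [show k₂ + t + 1 = k₂ + (t + 1) by ring, hr t, hr (t + 1)]
  rcases hletters (k₂ + t) (by omega) with hja | hja'
  · rw [hja]; omega
  · rw [hja']; omega

end LossFreeLedger

/-- **NO LOSS-FREE BINARY-CONE TAIL**: there is no isolated above-floor witnessed `Step0 p` chain with `x^{r₀} ∣ F₀`
which, from some `k₀` on, has constant natural shade `d < p`, polar-kernel rank `e_G ≡ 2`, and never translates a
boundary letter (`b k i ≠ 0 → (c k).r i = 0`).  Hence a binary-cone trap, if any, has infinitely many LOSSY steps.
[OURS] [cite: CossartJannsenSaito2020, Thm. 3.10(4), Thm. 3.14, Thm. 9.3, Lemma 13.2, Lemma 13.4, Thm. 13.7] -/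
theorem no_lossfree_tail (p : ℕ) [Fact p.Prime] [CharP K p] [DecidableEq K] {c : ℕ → State K} {j : ℕ → Fin 4}
    {b : ℕ → Fin 4 → K} (hc : ∀ k, IsIsolated p (c k).F ∧ Step0 p (c k) (c (k + 1)))
    (hw : FreeTail.IsWitnessedChain p c j b) (hr0 : ∀ e ∈ (c 0).F.support, (c 0).r ≤ e)
    (hfloor : ∀ k, ordZero (c k).F ≠ p) {k₀ d : ℕ} (hdp : d < p) (hshade : ∀ k, k₀ ≤ k → (c k).shade = (d : ℕ∞))
    (he : ∀ k, k₀ ≤ k → Module.finrank K (resVertex (c k)) = 2)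
    (hloss : ∀ k, k₀ ≤ k → ∀ i, b k i ≠ 0 → (c k).r i = 0) : False := by
  obtain ⟨k₂, a, a', hk₂, haa, hletters, hbdry, -, -⟩ := exists_pair_of_lossfree p hc hw hr0 hfloor hshade he hloss
  obtain ⟨k₃, hk₃, hlight⟩ := eventually_light_of_lossfree_pair p hc hw hr0 hfloor hdp
    (fun k hk => hshade k (by omega)) haa hletters (fun k hk => hloss k (by omega))
  exact no_light_pair_tail p hc hw hr0 hfloor hdp (fun k hk => hshade k (by omega)) haa
    (fun k hk => hletters k (by omega)) (fun k hk => he k (by omega)) (fun k hk => hbdry k (by omega)) hlight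

end ResCone

end Summit.ResolutionOfSingularities.ResolutionOfSingularities.Theorems.PIDim4

end
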